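import Summits.CriticalPhenomena.CardyFormulaZ2.Theorems.CardyMeckeFlipFlipErgodicityZ2StubLatticeSecondMomentReduction
import Summits.CriticalPhenomena.CardyFormulaZ2.Theorems.CardyMeckeFlipFlipErgodicityZ2StubLatticeSecondMomentEdgeArmPos

/-!
# Crux `FlipErgodicityZ2` (stmt-CriticalPhenomena-14825), line `registered`, stub
# `stub_kernelExistsZ2_of_lattice`: the lattice first moment of the unit ball is bounded below

Route `Summits/CriticalPhenomena/CardyFormulaZ2/Theses/CardyMeckeFlip`.  Helper file (supports the
crux item) for the stub "the Garban–Pete–Schramm pivotal kernel of a bond-`ℤ²` sublimit exists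
and is admissible" (`stub_kernelExistsZ2_of_lattice`).  Clause (ADM)(5) of admissibility asks
that SOME cutoff kernel charges the unit ball with positive expected mass,
`0 < ∫⁻ S, M ε S (ball 0 1) ∂μ`; its LATTICE side is a lower bound, uniform in the mesh, for the
expected mass that the isometry-averaged normalised `ε`-important measure
`μ^ε_δ(ω) = z2PivotalMeasure ε δ ω = Σ_e w_e(ω) δ_{mid e}` (`Z2PivotalMeasure.lean`) gives to
the unit ball.  This file proves it, with explicit constants:

* `z2EdgeFourArmProb_pos`, `pivotalRate_mul_z2EdgeFourArmProb` — **positivity of the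
  normalisation**: for `0 < δ ≤ 1` GPS's four-arm probability `α₄(δ,1) = z2EdgeFourArmProb δ` is
  positive (it is the reference probability `P(edgeFourArm [-⌊1/δ⌋,⌊1/δ⌋]² 0 0)`,
  `z2EdgeFourArmProb_eq`, positive by `real_edgeFourArm_box_pos`), so that the rate
  `r(δ) = δ²/α₄(δ,1)` satisfies `r(δ) α₄(δ,1) = δ²` (no junk division);
* `gridImportant_of_edgeFourArm_shiftBox` — for `0 < δ ≤ ε` with `4ε + 2δ ≤ 1`, an edge with four
  arms to the boundary of ITS OWN unit block `x + [-⌊1/δ⌋,⌊1/δ⌋]²` is `ε`-important for EVERY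
  moved `ε`-grid: the `3ε`-block of the grid square containing its midpoint lies within `4ε` of
  the midpoint (`gridBlock_gridIndex_subset`), hence inside the unit block, and contains both
  endpoints (`meshVertices_closedBall_subset_gridBlock`); arms restrict to sub-blocks
  (`edgeFourArm_of_subset`);
* `pivotalWeight_eq_of_edgeFourArm_shiftBox` — hence its averaged weight is the full rate
  `r(δ)`, and `lintegral_pivotalWeight_ge` — by translation invariance
  (`real_edgeFourArm_shiftBox_eq`) every edge has `E[w_e] ≥ r(δ) α₄(δ,1) = δ²`;
* `lintegral_z2PivotalMeasure_ball_ge` — summing over the `(2k+1)² ≥ 1/(16δ²)` horizontal edges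
  started in `[-k,k]²`, `k = ⌊1/(4δ)⌋`, whose midpoints lie in the unit ball:
  `E[μ^ε_δ(ball 0 1)] ≥ 1/16` for all `0 < δ ≤ ε ≤ 1/8`.
-/

noncomputable section

open MeasureTheory Set Filter Metric
open Literature.Probability.Percolation Literature.Probability.Percolation.QuadCrossing
open Literature.Probability.LatticeModels
open scoped ENNReal Topology

namespace Summit.CriticalPhenomena.CardyFormulaZ2.Theorems.CardyMeckeFlip

/-! ### Positivity of the normalisation -/

/-- At mesh `0 < δ ≤ 1` the unit block has lattice radius `⌊1/δ⌋ ≥ 1`. [folklore] -/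
theorem one_le_floor_inv {δ : ℝ} (hδ : 0 < δ) (hδ1 : δ ≤ 1) : 1 ≤ ⌊δ⁻¹⌋₊ :=
  Nat.le_floor (by rw [Nat.cast_one]; exact one_le_inv_iff₀.2 ⟨hδ, hδ1⟩)

/-- **Positivity of GPS's normalising four-arm probability**: `0 < α₄(δ,1) = z2EdgeFourArmProb δ`
for every mesh `0 < δ ≤ 1` (the reference event `edgeFourArm [-⌊1/δ⌋,⌊1/δ⌋]² 0 0` has positive
probability, `real_edgeFourArm_box_pos`). [folklore] -/
theorem z2EdgeFourArmProb_pos : ∀ δ : ℝ, 0 < δ → δ ≤ 1 → 0 < z2EdgeFourArmProb δ := by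
  intro δ hδ hδ1
  rw [z2EdgeFourArmProb_eq hδ]
  exact real_edgeFourArm_box_pos _ (one_le_floor_inv hδ hδ1)

/-- **No junk in the rate**: `r(δ) · α₄(δ,1) = δ²` for `0 < δ ≤ 1`. [folklore] -/
theorem pivotalRate_mul_z2EdgeFourArmProb {δ : ℝ} (hδ : 0 < δ) (hδ1 : δ ≤ 1) :
    pivotalRate δ * z2EdgeFourArmProb δ = δ ^ 2 := by
  rw [pivotalRate, div_mul_cancel₀ _ (z2EdgeFourArmProb_pos δ hδ hδ1).ne']

/-- The rate is positive for `0 < δ ≤ 1`. [folklore] -/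
theorem pivotalRate_pos {δ : ℝ} (hδ : 0 < δ) (hδ1 : δ ≤ 1) : 0 < pivotalRate δ :=
  div_pos (pow_pos hδ 2) (z2EdgeFourArmProb_pos δ hδ hδ1)

/-! ### Four arms to the unit block force `ε`-importance for every moved grid -/

/-- **The sites drawn within `4ε` of the midpoint of `s(x, x + eᵢ)` lie in the unit block
`x + [-⌊1/δ⌋,⌊1/δ⌋]²`** as soon as `4ε + 2δ ≤ 1` (`δ > 0`). [folklore] -/
theorem meshVertices_closedBall_subset_shiftBox {ε δ : ℝ} (hδ : 0 < δ) (h : 4 * ε + 2 * δ ≤ 1)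
    (x : Site 2) (i : Fin 2) :
    meshVertices (closedBall (edgeMidpoint δ x i) (4 * ε)) δ ⊆
      {u : Site 2 | u - x ∈ box 2 ⌊δ⁻¹⌋₊} := by
  intro u hu
  rw [mem_meshVertices_iff, mem_closedBall] at hu
  have hmid := dist_meshPoint_edgeMidpoint_le hδ x i
  have hux : dist (meshPoint δ u) (meshPoint δ x) ≤ 4 * ε + δ :=
    (dist_triangle_right _ _ (edgeMidpoint δ x i)).trans (add_le_add hu hmid)
  rw [dist_eq_norm] at hux
  have hmesh : meshPoint δ u - meshPoint δ x = (δ : ℂ) * Site.toComplex (u - x) := by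
    rw [meshPoint, meshPoint, toComplex_sub, mul_sub]
  rw [hmesh, norm_mul, Complex.norm_real, Real.norm_eq_abs, abs_of_pos hδ] at hux
  -- `⌊1/δ⌋ > 1/δ - 1 ≥ (4ε + δ)/δ`
  have hfloor : δ⁻¹ < (⌊δ⁻¹⌋₊ : ℝ) + 1 := Nat.lt_floor_add_one _
  have hcoord : ∀ j : Fin 2, |((u - x) j : ℝ)| ≤ ‖Site.toComplex (u - x)‖ := by
    intro j
    fin_cases j
    · simpa using Complex.abs_re_le_norm (Site.toComplex (u - x))
    · simpa using Complex.abs_im_le_norm (Site.toComplex (u - x))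
  simp only [mem_setOf_eq, mem_box]
  intro j
  have hj : δ * |((u - x) j : ℝ)| ≤ 4 * ε + δ :=
    (mul_le_mul_of_nonneg_left (hcoord j) hδ.le).trans hux
  have hlt : |((u - x) j : ℝ)| < ⌊δ⁻¹⌋₊ := by
    have h1 : |((u - x) j : ℝ)| ≤ (4 * ε + δ) / δ := by
      rw [le_div_iff₀ hδ, mul_comm]; exact hj
    have h2 : (4 * ε + δ) / δ ≤ δ⁻¹ - 1 := by
      rw [div_le_iff₀ hδ, sub_mul, inv_mul_cancel₀ hδ.ne', one_mul]
      linarith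
    linarith
  have hlt' : |(u - x) j| < (⌊δ⁻¹⌋₊ : ℤ) := by
    have : ((|(u - x) j| : ℤ) : ℝ) < ((⌊δ⁻¹⌋₊ : ℤ) : ℝ) := by
      rw [Int.cast_abs]; exact_mod_cast hlt
    exact_mod_cast this
  constructor <;> [linarith [(abs_lt.1 hlt').1]; linarith [(abs_lt.1 hlt').2]]

/-- **Four arms to the boundary of the unit block around the edge force `ε`-importance for
every moved `ε`-grid** (`0 < δ ≤ ε`, `4ε + 2δ ≤ 1`, lattice configuration): the `3ε`-block of
the grid square containing the midpoint lies inside the unit block and contains both endpoints,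
and arms restrict to sub-blocks. [folklore] -/
theorem gridImportant_of_edgeFourArm_shiftBox {ε δ : ℝ} (hδ : 0 < δ) (hδε : δ ≤ ε)
    (h : 4 * ε + 2 * δ ≤ 1) (θ : ℝ) (s : Bool) (a : ℂ) {ω : BondConfig (Site 2)}
    (hω : ω ⊆ (zdGraph 2).edgeSet) {x : Site 2} {i : Fin 2}
    (hA : ω ∈ edgeFourArm {u : Site 2 | u - x ∈ box 2 ⌊δ⁻¹⌋₊} x i) :
    ω ∈ gridImportant ε θ s a δ x i := by
  have hε : 0 < ε := hδ.trans_le hδε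
  have hend := norm_endpoints_sub_edgeMidpoint_le hδ x i
  unfold gridImportant
  refine edgeFourArm_of_subset
    ((gridBlock_gridIndex_subset hε θ s a δ (edgeMidpoint δ x i)).trans
      (meshVertices_closedBall_subset_shiftBox hδ h x i)) ?_ ?_ hω hA
  · refine meshVertices_closedBall_subset_gridBlock hε θ s a δ _ ?_
    rw [mem_meshVertices_iff, mem_closedBall, dist_eq_norm]
    exact hend.1.trans hδε
  · refine meshVertices_closedBall_subset_gridBlock hε θ s a δ _ ?_
    rw [mem_meshVertices_iff, mem_closedBall, dist_eq_norm]
    exact hend.2.trans hδε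

/-- **The averaged weight of an edge with four arms to the boundary of its unit block is the
full rate `r(δ)`** (`0 < δ ≤ ε`, `4ε + 2δ ≤ 1`, lattice configuration): every moved grid sees
it as `ε`-important, so both parameter sets are the whole parameter space. [folklore] -/
theorem pivotalWeight_eq_of_edgeFourArm_shiftBox {ε δ : ℝ} (hδ : 0 < δ) (hδε : δ ≤ ε)
    (h : 4 * ε + 2 * δ ≤ 1) {ω : BondConfig (Site 2)} (hω : ω ⊆ (zdGraph 2).edgeSet)
    {x : Site 2} {i : Fin 2} (hA : ω ∈ edgeFourArm {u : Site 2 | u - x ∈ box 2 ⌊δ⁻¹⌋₊} x i) :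
    pivotalWeight ε δ ω x i = ENNReal.ofReal (pivotalRate δ) := by
  have huniv : ∀ s : Bool,
      {q : ℝ × ℝ × ℝ | ω ∈ gridImportant ε q.1 s (gridShift q) δ x i} = univ := fun s =>
    eq_univ_of_forall fun q => gridImportant_of_edgeFourArm_shiftBox hδ hδε h q.1 s _ hω hA
  simp only [pivotalWeight, huniv, measure_univ]
  rw [one_add_one_eq_two, ENNReal.div_self two_ne_zero ENNReal.ofNat_ne_top, mul_one]

/-! ### Every edge has expected weight at least `δ²` -/

/-- **`E[w_e] ≥ δ²` for every edge `e` of `δℤ²`** (`0 < δ ≤ ε`, `4ε + 2δ ≤ 1`): the weight is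
the full rate on the four-arm event of the unit block around `e`, whose probability is
`α₄(δ,1)` by translation invariance, and `r(δ) α₄(δ,1) = δ²`. [folklore] -/
theorem lintegral_pivotalWeight_ge {ε δ : ℝ} (hδ : 0 < δ) (hδε : δ ≤ ε) (h : 4 * ε + 2 * δ ≤ 1)
    (x : Site 2) (i : Fin 2) :
    ENNReal.ofReal (δ ^ 2) ≤
      ∫⁻ ω, pivotalWeight ε δ ω x i ∂(bondPercolation (zdGraph 2) half) := by
  set P := bondPercolation (zdGraph 2) half with hP
  set A : Set (BondConfig (Site 2)) := edgeFourArm {u : Site 2 | u - x ∈ box 2 ⌊δ⁻¹⌋₊} x i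
    with hAdef
  have hδ1 : δ ≤ 1 := by
    have hε : 0 < ε := hδ.trans_le hδε
    linarith
  have hAm : MeasurableSet A := measurableSet_edgeFourArm (finite_shiftBox x _) x i
  have hPA : P A = ENNReal.ofReal (z2EdgeFourArmProb δ) := by
    rw [z2EdgeFourArmProb_eq hδ, ← real_edgeFourArm_shiftBox_eq x ⌊δ⁻¹⌋₊ i, ← hP, ← hAdef,
      ofReal_measureReal]
  calc ENNReal.ofReal (δ ^ 2)
      = ENNReal.ofReal (pivotalRate δ) * P A := by
        rw [hPA, ← ENNReal.ofReal_mul (pivotalRate_nonneg δ),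
          pivotalRate_mul_z2EdgeFourArmProb hδ hδ1]
    _ = ∫⁻ ω, A.indicator (fun _ => ENNReal.ofReal (pivotalRate δ)) ω ∂P :=
        (lintegral_indicator_const hAm _).symm
    _ ≤ ∫⁻ ω, pivotalWeight ε δ ω x i ∂P := by
        refine lintegral_mono_ae ?_
        filter_upwards [ae_subset_edgeSet (zdGraph 2) half] with ω hω
        by_cases hωA : ω ∈ A
        · rw [indicator_of_mem hωA, pivotalWeight_eq_of_edgeFourArm_shiftBox hδ hδε h hω hωA]
        · rw [indicator_of_notMem hωA]
          exact bot_le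

/-! ### The mass of the unit ball -/

/-- The mass of a set dominates the total weight of any finite set of edges whose midpoints it
contains. [folklore] -/
theorem sum_pivotalWeight_le_z2PivotalMeasure (ε δ : ℝ) (ω : BondConfig (Site 2)) {t : Set ℂ}
    (E : Finset (Site 2 × Fin 2)) (hE : ∀ p ∈ E, edgeMidpoint δ p.1 p.2 ∈ t) :
    ∑ p ∈ E, pivotalWeight ε δ ω p.1 p.2 ≤ z2PivotalMeasure ε δ ω t := by
  rw [z2PivotalMeasure_apply]
  calc ∑ p ∈ E, pivotalWeight ε δ ω p.1 p.2
      = ∑ p ∈ E, pivotalWeight ε δ ω p.1 p.2 * t.indicator 1 (edgeMidpoint δ p.1 p.2) :=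
        Finset.sum_congr rfl fun p hp => by rw [indicator_of_mem (hE p hp), Pi.one_apply, mul_one]
    _ ≤ ∑' p : Site 2 × Fin 2, pivotalWeight ε δ ω p.1 p.2 * t.indicator 1 (edgeMidpoint δ p.1 p.2) :=
        ENNReal.sum_le_tsum E

/-- **The horizontal edges started in `[-k,k]²`, `k = ⌊1/(4δ)⌋`, have their midpoints in the
unit ball** (`0 < δ ≤ 1/8`). [folklore] -/
theorem edgeMidpoint_mem_ball_of_mem_box {δ : ℝ} (hδ : 0 < δ) (hδ8 : δ ≤ 1 / 8) {x : Site 2}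
    (hx : x ∈ box 2 ⌊(4 * δ)⁻¹⌋₊) (i : Fin 2) : edgeMidpoint δ x i ∈ ball (0 : ℂ) 1 := by
  rw [mem_ball, dist_zero_right]
  have hk : (⌊(4 * δ)⁻¹⌋₊ : ℝ) ≤ (4 * δ)⁻¹ := Nat.floor_le (by positivity)
  have hmid := dist_meshPoint_edgeMidpoint_le hδ x i
  rw [dist_comm, dist_eq_norm] at hmid
  have hxnorm : ‖meshPoint δ x‖ ≤ 1 / 2 := by
    rw [meshPoint, norm_mul, Complex.norm_real, Real.norm_eq_abs, abs_of_pos hδ]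
    have hbox := mem_box.1 hx
    have hre : |(Site.toComplex x).re| ≤ ⌊(4 * δ)⁻¹⌋₊ := by
      rw [Site.toComplex_re, ← Int.cast_natCast, ← Int.cast_abs]
      exact_mod_cast abs_le.2 (hbox 0)
    have him : |(Site.toComplex x).im| ≤ ⌊(4 * δ)⁻¹⌋₊ := by
      rw [Site.toComplex_im, ← Int.cast_natCast, ← Int.cast_abs]
      exact_mod_cast abs_le.2 (hbox 1)
    calc δ * ‖Site.toComplex x‖
        ≤ δ * (|(Site.toComplex x).re| + |(Site.toComplex x).im|) :=
          mul_le_mul_of_nonneg_left (Complex.norm_le_abs_re_add_abs_im _) hδ.le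
      _ ≤ δ * ((4 * δ)⁻¹ + (4 * δ)⁻¹) := by gcongr <;> linarith
      _ = 1 / 2 := by field_simp; ring
  calc ‖edgeMidpoint δ x i‖
      ≤ ‖meshPoint δ x‖ + ‖edgeMidpoint δ x i - meshPoint δ x‖ := norm_le_insert' _ _
    _ ≤ 1 / 2 + δ := add_le_add hxnorm hmid
    _ < 1 := by linarith

/-- **The lattice first moment of the unit ball is bounded below, uniformly in the mesh**
(the lattice side of clause (ADM)(5) for the Garban–Pete–Schramm kernel of bond-`ℤ²`): for
`0 < δ ≤ ε ≤ 1/8`,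

  `1/16 ≤ E_{1/2}[μ^ε_δ(ω)(ball 0 1)]`,

`μ^ε_δ = z2PivotalMeasure ε δ` the isometry-averaged normalised `ε`-important measure.  Each of
the `(2k+1)² ≥ 1/(16δ²)` horizontal edges started in `[-k,k]²`, `k = ⌊1/(4δ)⌋`, has its midpoint
in the unit ball and expected weight `≥ δ²`. [folklore] -/
theorem lintegral_z2PivotalMeasure_ball_ge :
    ∀ ε : ℝ, 0 < ε → ε ≤ 1 / 8 → ∀ δ : ℝ, 0 < δ → δ ≤ ε →
      ENNReal.ofReal (1 / 16) ≤
        ∫⁻ ω, z2PivotalMeasure ε δ ω (Metric.ball 0 1) ∂(bondPercolation (zdGraph 2) half) := by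
  intro ε hε hε8 δ hδ hδε
  set P := bondPercolation (zdGraph 2) half with hP
  have hδ8 : δ ≤ 1 / 8 := hδε.trans hε8
  have h421 : 4 * ε + 2 * δ ≤ 1 := by linarith
  set k : ℕ := ⌊(4 * δ)⁻¹⌋₊ with hkdef
  set E : Finset (Site 2 × Fin 2) := box 2 k ×ˢ {0} with hEdef
  have hEball : ∀ p ∈ E, edgeMidpoint δ p.1 p.2 ∈ ball (0 : ℂ) 1 := by
    rintro ⟨x, i⟩ hp
    rw [hEdef, Finset.mem_product] at hp
    exact edgeMidpoint_mem_ball_of_mem_box hδ hδ8 hp.1 i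
  have hcard : (E.card : ℝ≥0∞) = ENNReal.ofReal ((2 * (k : ℝ) + 1) ^ 2) := by
    rw [hEdef, Finset.card_product, card_box, Finset.card_singleton, mul_one]
    rw [show ((2 * (k : ℝ) + 1) ^ 2) = (((2 * k + 1) ^ 2 : ℕ) : ℝ) by push_cast; ring,
      ENNReal.ofReal_natCast]
  -- `(2k+1) δ ≥ 1/2 - δ ≥ 3/8`
  have hklt : (4 * δ)⁻¹ < (k : ℝ) + 1 := Nat.lt_floor_add_one _
  have hkδ : 1 / 4 ≤ (2 * (k : ℝ) + 1) * δ := by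
    have h4 : (4 * δ)⁻¹ * δ = 1 / 4 := by field_simp
    nlinarith
  have hconst : (1 : ℝ) / 16 ≤ (2 * (k : ℝ) + 1) ^ 2 * δ ^ 2 := by
    have : (1 / 4 : ℝ) ^ 2 ≤ ((2 * (k : ℝ) + 1) * δ) ^ 2 :=
      pow_le_pow_left₀ (by norm_num) hkδ 2
    nlinarith
  calc ENNReal.ofReal (1 / 16)
      ≤ ENNReal.ofReal ((2 * (k : ℝ) + 1) ^ 2 * δ ^ 2) := ENNReal.ofReal_le_ofReal hconst
    _ = ∑ p ∈ E, ENNReal.ofReal (δ ^ 2) := by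
        rw [Finset.sum_const, nsmul_eq_mul, hcard, ← ENNReal.ofReal_mul (sq_nonneg _)]
    _ ≤ ∑ p ∈ E, ∫⁻ ω, pivotalWeight ε δ ω p.1 p.2 ∂P :=
        Finset.sum_le_sum fun p _ => lintegral_pivotalWeight_ge hδ hδε h421 p.1 p.2
    _ = ∫⁻ ω, ∑ p ∈ E, pivotalWeight ε δ ω p.1 p.2 ∂P :=
        (lintegral_finsetSum E fun p _ => measurable_pivotalWeight hε hδ p.1 p.2).symm
    _ ≤ ∫⁻ ω, z2PivotalMeasure ε δ ω (ball 0 1) ∂P :=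
        lintegral_mono fun ω => sum_pivotalWeight_le_z2PivotalMeasure ε δ ω E hEball

end Summit.CriticalPhenomena.CardyFormulaZ2.Theorems.CardyMeckeFlip

end
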